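import Summits.HodgeConjecture.CorCM.MultiFieldWeilUnitsMenuImprimitive
import Summits.HodgeConjecture.CorCM.MultiFieldWeilUnitsMenuGrouped
import HarnessLib

/-!
# MULTI-FIELD WEIL ENGINE — THE UNITS MENU WITH IMPRIMITIVE QUARTIC SINGLES, GROUPED BY FIELD: finitely many CM fields `K_j ∋ k`, over each a list of pairwise non-isogenous
# structures of the menu with independent centred type indicators, the octic fields either FLAGGED (degree-`24` pair; several classes) or UNFLAGGED (ANY quartic part; one
# `(1,3)`-class, linearly disjoint from the other closures) — the Hodge conjecture for every product of copies, given only Markman's fourfold and hyperbolic-sixfold theorems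

Cell `pub-hodgecm2` (COR-CM), seat b30 gen 40 (2026-08-26); count-neutral own lane MULTI-FIELD WEIL ENGINE (stem `MultiFieldWeil*`), the GROUPED restatement of
`CorCM/MultiFieldWeilUnitsMenuImprimitive.lean` (G4, slot form with a flag on the indices), exactly as `CorCM/MultiFieldWeilUnitsMenuGrouped.lean` (U7) restates U6: `J` finite,
fields `KJ j`, `c j` structures `B j t ⊨ (KJ j; Ψ j t)`, every hypothesis over ONE field term; a flag `tJ : J → Prop` on the fields.  Theorems only; no definition, no named fact,
no `sorry`.  HONEST FRAMING: conditional ONLY on the two displayed Markman binders; `HC_CM` is NOT proved and not asserted.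

**`hodgeConjectureFor_biproduct_sigma_imprimitive_of_linearIndependent`.**  `k` imaginary quadratic with `τ`, `E ⊨ (k; {τ})`; `J` finite; CM fields `KJ j ⊇ iK j (k)` of
degree `2·nJ j`; structures `B j t ⊨ (KJ j; Ψ j t)`, `t : Fin (c j)`, with `(nJ j, p_{j,t}) ∈ {(3,1), (4,1), (4,2), (5,2)}` (types NORMALISED); sextic `B j t` SIMPLE;
`B j t ≁ B j t'` for `t ≠ t'`; for `c j ≥ 3` the centred indicators of `(Ψ j t)_t` linearly independent over `ℚ`; FLAGGED octic fields (`tJ j`) with a degree-`24` pair;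
UNFLAGGED octic fields with `c j ≤ 1` and a type of ONE member over `τ` (a CM fourfold of `k`-signature `(1,3)` over an octic CM field with ARBITRARY quartic part) and, from
every other field `KJ j₀`, one `τ`-embedding `s` of `KJ j` with `[L(KJ j₀) ⊔ ℚ(s(KJ j)) : ℚ] = 4·[L(KJ j₀) : ℚ]`; decic fields with `c j ≥ 2` with a degree-`40` pair;
`Hom(KJ j', KJ j) = ∅` for `j ≠ j'` of equal degree (octic: both flagged); a value outside `L(KJ j)` for `KJ j` octic → `KJ j'` sextic and for `KJ j` unflagged octic → `KJ j'`
flagged octic.  THEN the Hodge conjecture holds for `⨁_l X_l`, every `X_l ∈ {E} ∪ {B j t}` (any multiplicities), GIVEN ONLY Markman's two theorems.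
PROOF: U7's enumeration of `Σ j, Fin (c j)` by `Fin r`, fields `Option.elim · k KJ`, flag `Option.elim · True tJ`, and G4.

[cite: Markman2025SurveySecant, Thm. 1.2] [cite: Markman2025SecantWeil, Thm 1.5.1] [cite: Shimura1998, §6.1 Corollary of Theorem 2, §8.2 Prop. 26, §8.4, §18.2 Lemma (i)]
[cite: Deligne1982HodgeCycles, §5 (b)] [cite: Lang2002, VI §1 Thm. 1.1, Cor. 1.6, Thm. 1.12, Thm. 1.14 and V §2 Thm. 2.8; XIII §4] [cite: MoonenZarhin1995Duke, Thm. 2.4]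
[cite: Pohlmann1968, Thm 1] [cite: DixonMortimer1996, §1.4 Ex. 1.4.1–1.4.2; §1.6, Thm. 1.6A; §2.1; §3.3, Thm. 3.3A] [cite: Dodson1984, §1.1 Imprimitivity Theorem and §5.1.2 Theorem]
[cite: MumfordAV1970, §19]

## References
* [Markman2025SurveySecant] E. Markman, arXiv:2509.23403, Thm. 1.2.  [Markman2025SecantWeil] E. Markman, Cycles on abelian 2n-folds of Weil type from secant sheaves on abelian
  n-folds, Thm 1.5.1.  [Shimura1998] G. Shimura, *Abelian varieties with complex multiplication and modular functions*, §6.1, §8.2, §8.4, §18.2.  [Deligne1982HodgeCycles]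
  P. Deligne, LNM 900, §5 (b).  [Lang2002] S. Lang, *Algebra*, GTM 211, V §2, VI §1, XIII §4.  [MoonenZarhin1995Duke] B. Moonen, Yu. Zarhin, Duke Math. J. 77 (1995), Thm. 2.4.
  [Pohlmann1968] H. Pohlmann, Ann. of Math. 88 (1968), Thm 1.  [DixonMortimer1996] J. D. Dixon, B. Mortimer, *Permutation Groups*, GTM 163.  [Dodson1984] B. Dodson, Trans. AMS
  283 (1984).  [MumfordAV1970] D. Mumford, *Abelian Varieties*, §19.
-/

noncomputable section

open CategoryTheory CategoryTheory.Limits NumberField IntermediateField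

namespace Summit.HodgeConjecture.CorCM.MultiFieldWeil

open Finset
open Literature.AlgebraicGeometry Literature.AlgebraicGeometry.Motives Literature.AlgebraicGeometry.HodgeTheory
open Literature.AlgebraicGeometry.ComplexMultiplication (IsCMTypeRealisation)
open Literature.AlgebraicTopology.SingularHomology
open Literature.NumberTheory.ComplexMultiplication

open scoped Classical

section Grouped

variable {J : Type} [Fintype J] {KJ : J → Type} [fK : ∀ j, Field (KJ j)] [nK : ∀ j, NumberField (KJ j)] [cK : ∀ j, IsCMField (KJ j)]
  {k : Type} [fk : Field k] [nk : NumberField k] [ck : IsCMField k] {τ : k →+* ℂ} {c : J → ℕ}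
  {B : ∀ j : J, Fin (c j) → AbelianVariety ℂ} {Ψ : ∀ j : J, Fin (c j) → CMType (KJ j)}
  {ιB : ∀ (j : J) (t : Fin (c j)), 𝓞 (KJ j) →+* End (B j t)} {θB : ∀ (j : J) (t : Fin (c j)), KJ j →+* Module.End ℂ (complexBetti (B j t).X 1)}
  {E : AbelianVariety ℂ} {Φ₀ : CMType k} {ιE : 𝓞 k →+* End E} {θE : k →+* Module.End ℂ (complexBetti E.X 1)}

/-- **THE UNITS MENU WITH IMPRIMITIVE QUARTIC SINGLES, GROUPED BY FIELD — GIVEN ONLY MARKMAN'S FOURFOLD AND HYPERBOLIC-SIXFOLD THEOREMS.**  See the module docstring.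
`HC_CM` is NOT asserted. [cite: Markman2025SurveySecant, Thm. 1.2] [cite: Markman2025SecantWeil, Thm 1.5.1] [cite: Shimura1998, §6.1 Corollary of Theorem 2, §8.2 Prop. 26, §18.2]
[cite: Deligne1982HodgeCycles, §5 (b)] [cite: Lang2002, VI §1 Thm. 1.1, Cor. 1.6, Thm. 1.12; XIII §4] [cite: DixonMortimer1996, §1.4 Ex. 1.4.1–1.4.2; §1.6, Thm. 1.6A; §2.1]
[cite: Dodson1984, §1.1 Imprimitivity Theorem and §5.1.2 Theorem] -/
theorem hodgeConjectureFor_biproduct_sigma_imprimitive_of_linearIndependent (hW4 : Markman2025_weilClasses_algebraic_abelianFourfold)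
    (hM6 : Markman2025_weilClasses_algebraic_hyperbolicSixfold) (h2 : Module.finrank ℚ k = 2) (iK : ∀ j : J, k →+* KJ j) (nJ : J → ℕ)
    (hdeg : ∀ j, Module.finrank ℚ (KJ j) = 2 * nJ j) (hB : ∀ j t, IsCMTypeRealisation (Ψ j t) (B j t) (ιB j t) (θB j t))
    (hE : IsCMTypeRealisation Φ₀ E ιE θE) (hΦ₀ : ∀ σ : k →+* ℂ, σ ∈ Φ₀.1 ↔ σ = τ) (tJ : J → Prop)
    (hS : ∀ j, nJ j = 3 → ∀ t, (B j t).IsSimple)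
    (hcnt : ∀ j t, (nJ j = 3 ∧ (Finset.univ.filter fun s : KJ j →+* ℂ => s.comp (iK j) = τ ∧ s ∈ (Ψ j t).1).card = 1) ∨
      (nJ j = 4 ∧ (Finset.univ.filter fun s : KJ j →+* ℂ => s.comp (iK j) = τ ∧ s ∈ (Ψ j t).1).card = 1) ∨
      (nJ j = 4 ∧ (Finset.univ.filter fun s : KJ j →+* ℂ => s.comp (iK j) = τ ∧ s ∈ (Ψ j t).1).card = 2) ∨
      (nJ j = 5 ∧ (Finset.univ.filter fun s : KJ j →+* ℂ => s.comp (iK j) = τ ∧ s ∈ (Ψ j t).1).card = 2))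
    (hni : ∀ j t t', t ≠ t' → ¬ AbelianVariety.IsIsogenous (B j t) (B j t'))
    (hone : ∀ j, nJ j = 4 → ¬ tJ j → c j ≤ 1 ∧ ∀ t, (Finset.univ.filter fun s : KJ j →+* ℂ => s.comp (iK j) = τ ∧ s ∈ (Ψ j t).1).card = 1)
    (hli : ∀ j, 2 < c j → LinearIndependent ℚ fun t : Fin (c j) => fun s : {s : KJ j →+* ℂ // s.comp (iK j) = τ} =>
      ((nJ j : ℚ) * (if s.1 ∈ (Ψ j t).1 then 1 else 0) - ((Finset.univ.filter fun u : KJ j →+* ℂ => u.comp (iK j) = τ ∧ u ∈ (Ψ j t).1).card : ℚ)))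
    (h24 : ∀ j, nJ j = 4 → tJ j → ∃ s₀ t₀ : KJ j →+* ℂ, s₀.comp (iK j) = τ ∧ t₀.comp (iK j) = τ ∧ s₀ ≠ t₀ ∧
      Module.finrank ℚ ↥(adjoin ℚ (Set.range τ) ⊔ adjoin ℚ (Set.range s₀ ∪ Set.range t₀)) = 24)
    (h40 : ∀ j, nJ j = 5 → 1 < c j → ∃ s₀ t₀ : KJ j →+* ℂ, s₀.comp (iK j) = τ ∧ t₀.comp (iK j) = τ ∧ s₀ ≠ t₀ ∧
      Module.finrank ℚ ↥(adjoin ℚ (Set.range τ) ⊔ adjoin ℚ (Set.range s₀ ∪ Set.range t₀)) = 40)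
    (hiso : ∀ j j' : J, j' ≠ j → nJ j = nJ j' → (nJ j' = 4 → tJ j' ∧ tJ j) → IsEmpty (KJ j' →+* KJ j))
    (hout4 : ∀ j j' : J, j' ≠ j → nJ j = 4 → (nJ j' = 3 ∨ (nJ j' = 4 ∧ tJ j' ∧ ¬ tJ j)) → ∃ s : KJ j' →+* ℂ, s.comp (iK j') = τ ∧ ∃ x, s x ∉ normalClosure ℚ (KJ j) ℂ)
    (hdisj : ∀ j j' : J, j' ≠ j → nJ j' = 4 → ¬ tJ j' → ∃ s : KJ j' →+* ℂ, s.comp (iK j') = τ ∧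
      Module.finrank ℚ ↥(normalClosure ℚ (KJ j) ℂ ⊔ adjoin ℚ (Set.range s)) = Module.finrank ℚ ↥(normalClosure ℚ (KJ j) ℂ) * 4)
    {N : ℕ} (κ : Fin N → Option ((j : J) × Fin (c j))) :
    HodgeConjectureFor (⨁ fun l => ((κ l).elim E fun x => B x.1 x.2 : AbelianVariety ℂ)).dim (⨁ fun l => ((κ l).elim E fun x => B x.1 x.2 : AbelianVariety ℂ)).X := by
  -- enumerate the structures
  let S : Type := (j : J) × Fin (c j)
  let σ : Fin (Fintype.card S) ≃ S := (Fintype.equivFin S).symm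
  -- the fields `Option.elim · k KJ` with their instances (F2's pattern)
  let Kf : Option J → Type := fun o => o.elim k KJ
  letI instF : ∀ o, Field (Kf o) := fun o => @Option.rec J (fun o => Field (Option.elim o k KJ)) fk (fun j => fK j) o
  letI instN : ∀ o, NumberField (Kf o) := fun o => @Option.rec J (fun o => NumberField (Option.elim o k KJ)) nk (fun j => nK j) o
  haveI instC : ∀ o, IsCMField (Kf o) := fun o => @Option.rec J (fun o => IsCMField (Option.elim o k KJ)) ck (fun j => cK j) o
  let is : Fin (Fintype.card S) → Option J := fun m => some (σ m).1
  let iK' : ∀ o : Option J, Kf none →+* Kf o := fun o => @Option.rec J (fun o => k →+* Option.elim o k KJ) (RingHom.id k) (fun j => iK j) o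
  let nI : Option J → ℕ := fun o => o.elim 0 nJ
  let tI : Option J → Prop := fun o => o.elim True tJ
  obtain ⟨Φ', ι', θ', hA', h0, hQ⟩ := exists_realisations_cons_of (Kf := Kf) (i₀ := none) (is := is) (T := fun m => B (σ m).1 (σ m).2)
    (ΦT := fun m => Ψ (σ m).1 (σ m).2) (ιT := fun m => ιB (σ m).1 (σ m).2) (θT := fun m => θB (σ m).1 (σ m).2) (Ψ := Φ₀) (E := E) (ιE := ιE) (θE := θE) hE
    (fun m => hB (σ m).1 (σ m).2) (fun m Φ'' => Φ'' = Ψ (σ m).1 (σ m).2) (fun m => rfl)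
  have hΨ' : ∀ s : Kf none →+* ℂ, s ∈ (Φ' 0).1 ↔ s = τ := by rw [h0]; exact hΦ₀
  -- two structures over one field, transported along the enumeration
  have hniS : ∀ x y : S, x ≠ y → y.1 = x.1 → ¬ AbelianVariety.IsIsogenous (B x.1 x.2) (B y.1 y.2) := by
    rintro ⟨j, t⟩ ⟨j', t'⟩ hne h
    dsimp only at h
    subst h
    exact hni _ t t' fun htt => hne (by rw [htt])
  have heqS : ∀ (x : S) (j₀ : J) (h : x.1 = j₀) (X : CMType (KJ j₀)), HEq X (Ψ x.1 x.2) → X = Ψ j₀ (Fin.cast (congrArg c h) x.2) := by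
    rintro ⟨j, t⟩ j₀ h X hX
    dsimp only at h
    subst h
    rw [(Fin.ext rfl : Fin.cast _ t = t)]
    exact eq_of_heq hX
  -- the fibre of a slot maps injectively into `Fin (c j)`
  have hfib : ∀ m₀ : Fin (Fintype.card S), ∃ f : {m // is m = is m₀} → Fin (c (σ m₀).1), Function.Injective f ∧
      ∀ m, f m = Fin.cast (congrArg c (Option.some.inj m.2)) (σ m.1).2 := by
    intro m₀
    refine ⟨fun m => Fin.cast (congrArg c (Option.some.inj m.2)) (σ m.1).2, fun m m' hmm => ?_, fun m => rfl⟩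
    have h1 : (σ m.1).1 = (σ m'.1).1 := (Option.some.inj m.2).trans (Option.some.inj m'.2).symm
    have h2 : HEq (σ m.1).2 (σ m'.1).2 := (Fin.heq_ext_iff (congrArg c h1)).2 (by simpa only [Fin.val_cast] using congrArg Fin.val hmm)
    exact Subtype.ext (σ.injective (Sigma.ext h1 h2))
  -- U6 for the enumerated family
  have key : HodgeConjectureFor
      (⨁ fun l => (Fin.cons E (fun m => B (σ m).1 (σ m).2) : Fin (Fintype.card S + 1) → AbelianVariety ℂ) ((κ l).elim 0 fun x => (σ.symm x).succ)).dim
      (⨁ fun l => (Fin.cons E (fun m => B (σ m).1 (σ m).2) : Fin (Fintype.card S + 1) → AbelianVariety ℂ) ((κ l).elim 0 fun x => (σ.symm x).succ)).X :=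
    hodgeConjectureFor_biproduct_comp_of_unitsMenu_imprimitive_of_linearIndependent (Kf := Kf) (i₀ := none) (is := is) hW4 hM6
    (fun l => (κ l).elim 0 fun x => (σ.symm x).succ) h2 nI (fun m => hdeg (σ m).1) iK' hA' hΨ' tI
    (fun m h => by rw [Fin.cons_succ]; exact hS _ h _)
    (fun m => by rw [hQ m]; exact hcnt (σ m).1 (σ m).2)
    (fun m m' hne h => by
      rw [Fin.cons_succ, Fin.cons_succ]
      exact hniS (σ m) (σ m') (fun hs => hne (σ.injective hs).symm) (Option.some.inj h))
    (fun m h4 ht => by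
      obtain ⟨hc1, hcnt1⟩ := hone (σ m).1 h4 ht
      refine ⟨by rw [hQ m]; exact hcnt1 (σ m).2, fun m' hm' => ?_⟩
      obtain ⟨f, hf, -⟩ := hfib m
      have hx : f ⟨m', hm'⟩ = f ⟨m, rfl⟩ := Fin.ext (by have h1 := (f ⟨m', hm'⟩).2; have h2 := (f ⟨m, rfl⟩).2; omega)
      exact congrArg Subtype.val (hf hx))
    (fun m₀ ⟨m₁, m₂, h12, h10, h20, hi1, hi2⟩ Ψ'' hΨ'' => by
      obtain ⟨f, hf, hfeq⟩ := hfib m₀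
      have hc : 2 < c (σ m₀).1 := by
        have h3 : ({f ⟨m₀, rfl⟩, f ⟨m₁, hi1⟩, f ⟨m₂, hi2⟩} : Finset (Fin (c (σ m₀).1))).card = 3 :=
          Finset.card_eq_three.2 ⟨_, _, _, fun h => h10 (congrArg Subtype.val (hf h)).symm, fun h => h20 (congrArg Subtype.val (hf h)).symm,
            fun h => h12 (congrArg Subtype.val (hf h)), rfl⟩
        have := Finset.card_le_univ ({f ⟨m₀, rfl⟩, f ⟨m₁, hi1⟩, f ⟨m₂, hi2⟩} : Finset (Fin (c (σ m₀).1)))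
        rw [h3, Fintype.card_fin] at this
        omega
      have hΨeq : ∀ m, Ψ'' m = Ψ (σ m₀).1 (f m) := fun m => by
        rw [hfeq m]
        exact heqS (σ m.1) (σ m₀).1 (Option.some.inj m.2) (Ψ'' m) ((hΨ'' m).trans (heq_of_eq (hQ m.1)))
      have hfun : (fun m : {m // is m = is m₀} => fun s : {s : Kf (is m₀) →+* ℂ // s.comp (iK' (is m₀)) = τ} =>
          ((nI (is m₀) : ℚ) * (if s.1 ∈ (Ψ'' m).1 then 1 else 0) -
            ((Finset.univ.filter fun u : Kf (is m₀) →+* ℂ => u.comp (iK' (is m₀)) = τ ∧ u ∈ (Ψ'' m).1).card : ℚ))) =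
          (fun t : Fin (c (σ m₀).1) => fun s : {s : KJ (σ m₀).1 →+* ℂ // s.comp (iK (σ m₀).1) = τ} =>
            ((nJ (σ m₀).1 : ℚ) * (if s.1 ∈ (Ψ (σ m₀).1 t).1 then 1 else 0) -
              ((Finset.univ.filter fun u : KJ (σ m₀).1 →+* ℂ => u.comp (iK (σ m₀).1) = τ ∧ u ∈ (Ψ (σ m₀).1 t).1).card : ℚ))) ∘ f := by
        funext m; rw [Function.comp_apply, hΨeq m]; rfl
      rw [hfun]
      exact (hli (σ m₀).1 hc).comp f hf)
    (fun m h4 ht => h24 (σ m).1 h4 ht) (fun m h5 ⟨m', hne, heq⟩ => by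
      obtain ⟨f, hf, -⟩ := hfib m
      refine h40 (σ m).1 h5 ?_
      have h2c : ({f ⟨m, rfl⟩, f ⟨m', heq⟩} : Finset (Fin (c (σ m).1))).card = 2 := Finset.card_pair fun h => hne (congrArg Subtype.val (hf h)).symm
      have := Finset.card_le_univ ({f ⟨m, rfl⟩, f ⟨m', heq⟩} : Finset (Fin (c (σ m).1)))
      rw [h2c, Fintype.card_fin] at this
      omega)
    (fun m₀ m hne hn hfl => hiso (σ m₀).1 (σ m).1 (fun h => hne (congrArg some h)) hn hfl)
    (fun m₀ m hne h4 h => hout4 (σ m₀).1 (σ m).1 (fun h' => hne (congrArg some h')) h4 h)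
    (fun m₀ m hne h4 ht => hdisj (σ m₀).1 (σ m).1 (fun h' => hne (congrArg some h')) h4 ht)
  -- the two families of factors agree
  have hfam : (fun l => (Fin.cons E (fun m => B (σ m).1 (σ m).2) : Fin (Fintype.card S + 1) → AbelianVariety ℂ) ((κ l).elim 0 fun x => (σ.symm x).succ)) =
      fun l => ((κ l).elim E fun x => B x.1 x.2 : AbelianVariety ℂ) := by
    funext l
    rcases hκ : κ l with _ | x
    · rfl
    · show (Fin.cons E (fun m => B (σ m).1 (σ m).2) : Fin (Fintype.card S + 1) → AbelianVariety ℂ) (σ.symm x).succ = B x.1 x.2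
      rw [Fin.cons_succ]
      exact congrArg (fun y : S => B y.1 y.2) (σ.apply_symm_apply x)
  rw [hfam] at key
  exact key

end Grouped

end Summit.HodgeConjecture.CorCM.MultiFieldWeil

end
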